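import Summits.CriticalPhenomena.CardyFormulaZ2.Theses.CardyRotToConf
import Summits.CriticalPhenomena.CardyFormulaZ2.Theorems.CardyRotToConfR2SymmetryUpgrade.Negative.SurgSubarcImages
import Literature.Probability.RandomPlanarGeometry.LoewnerGrowth
import Literature.Probability.RandomPlanarGeometry.ConformalRestrictionProofs
import HarnessLib

/-!
# Chordal SLE traces no boundary arc: the non-tracing clause of `CardyRotToConfR2SymmetryUpgrade`
# (stmt-CriticalPhenomena-0698) for a family of chordal SLE₆ laws

Stub `stub_nonTracing` of line `germ-label-transport` (lead skeleton
`Cruxes/CardyRotToConfR2SymmetryUpgrade/GermLabelTransport`): for every family `Q` of chordal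
SLE₆ laws (`∀ D, IsSLELaw 6 D (Q D)`) and every Dobrushin domain `D`, `Q D`-a.e. curve class has
NO representative mapping a non-trivial parameter interval `[s, t]`, `s < t`, into `∂D` other than
constantly. In fact the statement holds for every `κ` (`ae_nonTracing_of_isSLELaw`).

Proof.
* **Deterministic Loewner input** (`Loewner.exists_mem_upperHalfPlaneSet_of_isGeneratedByCurve`):
  a curve generating the Loewner chain of a continuous driving function visits the OPEN upper
  half-plane during every non-trivial time interval `[S, T]`: otherwise `ℍ ∖ γ[0, T] = ℍ ∖ γ[0, S]`,
  so `K_T = K_S`, contradicting the strict growth of the hulls (`Loewner.hull_ssubset_hull`,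
  Lawler (2005) Thm. 4.6: `hcap K_t = 2t`).
* **One representative** (`Negative.forall_rep_notrace_iff`, sub-arc images are class invariants):
  it suffices to treat the time-compactified image `c` of the SLE trace under the boundary
  extension `Φ` of the chordal uniformizing map `φ : ℍ → D` (`IsSLECurve`). On `ℍ` the extension
  `Φ` is `φ`, with values in the open set `D`, disjoint from `∂D`; so `c '' [s, t] ⊆ ∂D` with
  `s < t` forces the trace to avoid `ℍ` during the time interval `[ray s, ray t₁]`,
  `t₁ = (s + t)/2 < 1`, which the Loewner input forbids.
* **Transport to the law** (`ae_map_iff`): the tracing event is Borel. Its quantitative version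
  "some representative has a sub-arc inside the closed set `F` containing two points at distance
  `≥ ε`" is CLOSED in curve space (`CurveClass.isClosed_setOf_subarc_subset`: sup-close
  reparametrisations, compactness of `[0, 1]⁴`, closedness of `F`), and the tracing event is the
  union over `ε = 1/(n+1)` (`CurveClass.measurableSet_setOf_traces`).

References: G. F. Lawler, *Conformally Invariant Processes in the Plane*, AMS (2005), §4.1
(Thm. 4.6) and §6.3; M. Aizenman, A. Burchard, Duke Math. J. 99 (1999), §2.1 (curve space).
-/

noncomputable section

open Set MeasureTheory Topology Filter Metric
open scoped unitInterval NNReal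

namespace Summit.CriticalPhenomena.CardyFormulaZ2.Theorems.CardyRotToConfR2SymmetryUpgrade

open Literature.Probability.RandomPlanarGeometry
open Literature.Probability.RandomPlanarGeometry.ChordalFamily
open Summit.CriticalPhenomena.CardyFormulaZ2.Theorems.CardyRotToConfR2SymmetryUpgrade.Negative
open UpperHalfPlane (upperHalfPlaneSet)

/-! ### The tracing event is Borel -/

section TracingEvent

variable {E : Type*} [MetricSpace E]

/-- **The quantitative tracing event is closed.** For a closed set `F` and `ε : ℝ`, the set of
curve classes having a representative `c` and a parameter interval `[s, t]`, `s ≤ t`, with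
`c '' [s, t] ⊆ F` and two parameters `u, v ∈ [s, t]` with `ε ≤ dist (c u) (c v)` is closed in
`CurveClass E`: along a convergent sequence of such classes, sup-close reparametrisations of the
representatives converge uniformly to a representative of the limit, a subsequence of the
witnesses `(s, t, u, v)` converges in the compact `[0, 1]⁴`, and the two defining conditions pass
to the limit (`F` closed, `dist` continuous) (Aizenman–Burchard 1999, §2.1). [folklore] -/
theorem CurveClass.isClosed_setOf_subarc_subset {F : Set E} (hF : IsClosed F) (ε : ℝ) :
    IsClosed {γ : CurveClass E | ∃ c : Curve E, CurveClass.mk c = γ ∧ ∃ s t : I, s ≤ t ∧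
      (c : I → E) '' Icc s t ⊆ F ∧ ∃ u ∈ Icc s t, ∃ v ∈ Icc s t, ε ≤ dist (c u) (c v)} := by
  refine IsSeqClosed.isClosed fun x γ hx hlim ↦ ?_
  obtain ⟨c, rfl⟩ := CurveClass.surjective_mk γ
  choose c' hmk s t hst hsub u hu v hv hε using hx
  -- sup-close reparametrisations of the representatives `c' n`
  have hdist : Tendsto (fun n ↦ dist c (c' n)) atTop (𝓝 0) := by
    refine (tendsto_iff_dist_tendsto_zero.1 hlim).congr fun n ↦ ?_
    rw [← hmk n, CurveClass.dist_mk_mk, dist_comm]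
  set δ : ℕ → ℝ := fun n ↦ dist c (c' n) + 1 / ((n : ℝ) + 1) with hδ
  have hδlim : Tendsto δ atTop (𝓝 0) := by
    have h := hdist.add tendsto_one_div_add_atTop_nhds_zero_nat
    rw [add_zero] at h
    exact h
  have hex : ∀ n, ∃ φ : I ≃o I,
      dist c.toContinuousMap ((c' n).reparam φ).toContinuousMap < δ n := fun n ↦
    Curve.exists_dist_reparam_lt (lt_add_of_pos_right _ (by positivity))
  choose φ hφ using hex
  have hpt : ∀ n (w : I), dist (c w) (c' n (φ n w)) < δ n := fun n w ↦
    (ContinuousMap.dist_apply_le_dist (f := c.toContinuousMap)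
      (g := ((c' n).reparam (φ n)).toContinuousMap) w).trans_lt (hφ n)
  -- pulled-back witnesses and a convergent subsequence in `[0, 1]⁴`
  set s' : ℕ → I := fun n ↦ (φ n).symm (s n) with hs'
  set t' : ℕ → I := fun n ↦ (φ n).symm (t n) with ht'
  set u' : ℕ → I := fun n ↦ (φ n).symm (u n) with hu'
  set v' : ℕ → I := fun n ↦ (φ n).symm (v n) with hv'
  have hφs : ∀ n, φ n (s' n) = s n := fun n ↦ (φ n).apply_symm_apply _
  have hφt : ∀ n, φ n (t' n) = t n := fun n ↦ (φ n).apply_symm_apply _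
  have hφu : ∀ n, φ n (u' n) = u n := fun n ↦ (φ n).apply_symm_apply _
  have hφv : ∀ n, φ n (v' n) = v n := fun n ↦ (φ n).apply_symm_apply _
  have hs't' : ∀ n, s' n ≤ t' n := fun n ↦ (φ n).symm.monotone (hst n)
  have hs'u' : ∀ n, s' n ≤ u' n := fun n ↦ (φ n).symm.monotone (hu n).1
  have hu't' : ∀ n, u' n ≤ t' n := fun n ↦ (φ n).symm.monotone (hu n).2
  have hs'v' : ∀ n, s' n ≤ v' n := fun n ↦ (φ n).symm.monotone (hv n).1
  have hv't' : ∀ n, v' n ≤ t' n := fun n ↦ (φ n).symm.monotone (hv n).2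
  obtain ⟨⟨⟨s₀, t₀⟩, ⟨u₀, v₀⟩⟩, ψ, hψ, hlim'⟩ :=
    CompactSpace.tendsto_subseq fun n ↦ ((s' n, t' n), (u' n, v' n))
  have hs₀ : Tendsto (fun k ↦ s' (ψ k)) atTop (𝓝 s₀) := hlim'.fst_nhds.fst_nhds
  have ht₀ : Tendsto (fun k ↦ t' (ψ k)) atTop (𝓝 t₀) := hlim'.fst_nhds.snd_nhds
  have hu₀ : Tendsto (fun k ↦ u' (ψ k)) atTop (𝓝 u₀) := hlim'.snd_nhds.fst_nhds
  have hv₀ : Tendsto (fun k ↦ v' (ψ k)) atTop (𝓝 v₀) := hlim'.snd_nhds.snd_nhds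
  -- evaluation of the reparametrised representatives along the subsequence converges to `c`
  have hkey : ∀ {w : ℕ → I} {w₀ : I}, Tendsto w atTop (𝓝 w₀) →
      Tendsto (fun k ↦ c' (ψ k) (φ (ψ k) (w k))) atTop (𝓝 (c w₀)) := by
    intro w w₀ hw
    rw [tendsto_iff_dist_tendsto_zero]
    have h1 : Tendsto (fun k ↦ dist (c (w k)) (c w₀)) atTop (𝓝 0) :=
      tendsto_iff_dist_tendsto_zero.1 ((c.continuous.tendsto w₀).comp hw)
    have h2 : Tendsto (fun k ↦ δ (ψ k)) atTop (𝓝 0) := hδlim.comp hψ.tendsto_atTop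
    refine squeeze_zero (fun _ ↦ dist_nonneg) (fun k ↦ ?_) (by simpa using h2.add h1)
    calc dist (c' (ψ k) (φ (ψ k) (w k))) (c w₀)
        ≤ dist (c' (ψ k) (φ (ψ k) (w k))) (c (w k)) + dist (c (w k)) (c w₀) :=
          dist_triangle _ _ _
      _ ≤ δ (ψ k) + dist (c (w k)) (c w₀) := by
          gcongr
          rw [dist_comm]
          exact (hpt (ψ k) (w k)).le
  -- the limit witnesses
  have h₀st : s₀ ≤ t₀ := le_of_tendsto_of_tendsto' hs₀ ht₀ fun k ↦ hs't' (ψ k)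
  have h₀su : s₀ ≤ u₀ := le_of_tendsto_of_tendsto' hs₀ hu₀ fun k ↦ hs'u' (ψ k)
  have h₀ut : u₀ ≤ t₀ := le_of_tendsto_of_tendsto' hu₀ ht₀ fun k ↦ hu't' (ψ k)
  have h₀sv : s₀ ≤ v₀ := le_of_tendsto_of_tendsto' hs₀ hv₀ fun k ↦ hs'v' (ψ k)
  have h₀vt : v₀ ≤ t₀ := le_of_tendsto_of_tendsto' hv₀ ht₀ fun k ↦ hv't' (ψ k)
  have hmemF : ∀ w ∈ Icc s₀ t₀, c w ∈ F := by
    intro w hw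
    set wk : ℕ → I := fun k ↦ max (s' (ψ k)) (min w (t' (ψ k))) with hwk
    have hwlim : Tendsto wk atTop (𝓝 w) := by
      have : Tendsto wk atTop (𝓝 (max s₀ (min w t₀))) := hs₀.max (tendsto_const_nhds.min ht₀)
      rwa [min_eq_left hw.2, max_eq_right hw.1] at this
    refine hF.mem_of_tendsto (hkey hwlim) (Eventually.of_forall fun k ↦
      hsub (ψ k) ⟨φ (ψ k) (wk k), ⟨?_, ?_⟩, rfl⟩)
    · have := (φ (ψ k)).monotone (le_max_left (s' (ψ k)) (min w (t' (ψ k))))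
      rwa [hφs] at this
    · have := (φ (ψ k)).monotone (max_le (hs't' (ψ k)) (min_le_right w (t' (ψ k))))
      rwa [hφt] at this
  have hεlim : ε ≤ dist (c u₀) (c v₀) := by
    refine ge_of_tendsto' ((hkey hu₀).dist (hkey hv₀)) fun k ↦ ?_
    change ε ≤ dist (c' (ψ k) (φ (ψ k) (u' (ψ k)))) (c' (ψ k) (φ (ψ k) (v' (ψ k))))
    rw [hφu, hφv]
    exact hε (ψ k)
  exact ⟨c, rfl, s₀, t₀, h₀st, fun _ ⟨w, hw, hcw⟩ ↦ hcw ▸ hmemF w hw, u₀, ⟨h₀su, h₀ut⟩, v₀,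
    ⟨h₀sv, h₀vt⟩, hεlim⟩

/-- **The tracing event is Borel.** For a closed set `F`, the set of curve classes having a
representative which maps some non-trivial parameter interval `[s, t]`, `s < t`, into `F`
non-constantly is a countable union of the closed quantitative events of
`CurveClass.isClosed_setOf_subarc_subset` (`ε = 1/(n+1)`), hence measurable
(Aizenman–Burchard 1999, §2.1). [folklore] -/
theorem CurveClass.measurableSet_setOf_traces {F : Set E} (hF : IsClosed F) :
    MeasurableSet {γ : CurveClass E | ∃ c : Curve E, CurveClass.mk c = γ ∧ ∃ s t : I, s < t ∧
      (c : I → E) '' Icc s t ⊆ F ∧ ¬ ((c : I → E) '' Icc s t).Subsingleton} := by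
  have heq : {γ : CurveClass E | ∃ c : Curve E, CurveClass.mk c = γ ∧ ∃ s t : I, s < t ∧
      (c : I → E) '' Icc s t ⊆ F ∧ ¬ ((c : I → E) '' Icc s t).Subsingleton} =
      ⋃ n : ℕ, {γ : CurveClass E | ∃ c : Curve E, CurveClass.mk c = γ ∧ ∃ s t : I, s ≤ t ∧
        (c : I → E) '' Icc s t ⊆ F ∧ ∃ u ∈ Icc s t, ∃ v ∈ Icc s t,
          1 / ((n : ℝ) + 1) ≤ dist (c u) (c v)} := by
    ext γ
    simp only [mem_setOf_eq, mem_iUnion]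
    constructor
    · rintro ⟨c, hc, s, t, hst, hsub, hns⟩
      obtain ⟨_, ⟨u, hu, rfl⟩, _, ⟨v, hv, rfl⟩, hne⟩ := not_subsingleton_iff.1 hns
      obtain ⟨n, hn⟩ := exists_nat_one_div_lt (dist_pos.2 hne)
      exact ⟨n, c, hc, s, t, hst.le, hsub, u, hu, v, hv, hn.le⟩
    · rintro ⟨n, c, hc, s, t, hst, hsub, u, hu, v, hv, hn⟩
      have hne : c u ≠ c v := dist_pos.1 (lt_of_lt_of_le (by positivity) hn)
      have huv : u ≠ v := fun h ↦ hne (h ▸ rfl)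
      refine ⟨c, hc, s, t, ?_, hsub, fun hsing ↦ hne (hsing ⟨u, hu, rfl⟩ ⟨v, hv, rfl⟩)⟩
      rcases hst.lt_or_eq with hlt | rfl
      · exact hlt
      · exact absurd (le_antisymm (hu.2.trans hv.1) (hv.2.trans hu.1)) huv
  rw [heq]
  exact MeasurableSet.iUnion fun n ↦ (CurveClass.isClosed_setOf_subarc_subset hF _).measurableSet

/-- The non-tracing event (no representative maps a non-trivial parameter interval into the
closed set `F` non-constantly) is Borel: it is the complement of the tracing event. [folklore] -/
theorem CurveClass.measurableSet_setOf_notrace {F : Set E} (hF : IsClosed F) :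
    MeasurableSet {γ : CurveClass E | ∀ c : Curve E, CurveClass.mk c = γ → ∀ s t : I, s < t →
      (c : I → E) '' Icc s t ⊆ F → ((c : I → E) '' Icc s t).Subsingleton} := by
  convert (CurveClass.measurableSet_setOf_traces hF).compl using 1
  ext γ
  simp only [mem_setOf_eq, mem_compl_iff, not_exists, not_and, not_not]

end TracingEvent

/-! ### Deterministic input: a generating curve does not rest on the real line -/

/-- **A generating curve visits `ℍ` in every non-trivial time interval.** If the Loewner chain
of a continuous driving function `W` is generated by `γ` and `S < T`, then `γ τ ∈ ℍ` for some
`τ ∈ [S, T]`: otherwise `ℍ ∖ γ[0, T] = ℍ ∖ γ[0, S]`, hence `K_T = K_S` by the defining property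
of a generating curve, contradicting the strict growth `K_S ⊊ K_T` of the hulls
(`Loewner.hull_ssubset_hull`; Lawler (2005), Thm. 4.6, `hcap K_t = 2t`). [cite: Lawler2005, Thm. 4.6] -/
theorem Loewner.exists_mem_upperHalfPlaneSet_of_isGeneratedByCurve {W : ℝ≥0 → ℝ} {γ : ℝ≥0 → ℂ}
    (hW : Continuous W) (h : Loewner.IsGeneratedByCurve W γ) {S T : ℝ≥0} (hST : S < T) :
    ∃ τ ∈ Icc S T, γ τ ∈ upperHalfPlaneSet := by
  by_contra hno
  simp only [not_exists, not_and] at hno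
  have hset : upperHalfPlaneSet \ γ '' Icc 0 T = upperHalfPlaneSet \ γ '' Icc 0 S := by
    ext z
    simp only [Set.mem_sdiff, mem_image, mem_Icc, zero_le, true_and, not_exists, not_and]
    refine ⟨fun hz ↦ ⟨hz.1, fun τ hτ ↦ hz.2 τ (hτ.trans hST.le)⟩, fun hz ↦ ⟨hz.1, fun τ hτ heq ↦ ?_⟩⟩
    rcases le_or_gt τ S with hτS | hτS
    · exact hz.2 τ hτS heq
    · refine hno τ ⟨hτS.le, hτ⟩ ?_
      rw [heq]
      exact hz.1
  have hsub : Loewner.hull W T ⊆ Loewner.hull W S := by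
    rw [h.hull_eq T, h.hull_eq S, hset]
  exact (Loewner.hull_ssubset_hull hW hST).2 hsub

/-! ### SLE laws charge only non-tracing classes -/

/-- `rayParam` is strictly increasing on `[0, 1)`: `a < b < 1 → ray a < ray b`. [folklore] -/
theorem rayParam_lt_rayParam {a b : I} (hab : a < b) (hb : (b : ℝ) < 1) :
    rayParam a < rayParam b := by
  have ha : (a : ℝ) < 1 := lt_of_lt_of_le (show (a : ℝ) < b from hab) hb.le
  rw [← NNReal.coe_lt_coe, coe_rayParam, coe_rayParam, div_lt_div_iff₀ (sub_pos.2 ha) (sub_pos.2 hb)]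
  have : (a : ℝ) < b := hab
  nlinarith

/-- **An SLE_κ law charges only classes tracing no boundary arc.** If `μ` is a chordal SLE_κ law
in the Dobrushin domain `(D; a, b)`, then `μ`-a.e. curve class has no representative mapping a
non-trivial parameter interval into `∂D` non-constantly. By `IsSLECurve`, a.s. the class is that
of the time-compactified image `c = Φ ∘ γ ∘ ray` of the generating trace `γ` under the boundary
extension `Φ` of a uniformizing map `φ : ℍ → D`; one representative suffices
(`forall_rep_notrace_iff`); `Φ = φ` on `ℍ` takes values in the open set `D`, off `∂D`, so
`c '' [s, t] ⊆ ∂D`, `s < t`, would keep `γ` off `ℍ` during `[ray s, ray ((s+t)/2)]`, impossible by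
`Loewner.exists_mem_upperHalfPlaneSet_of_isGeneratedByCurve`; the event is Borel
(`CurveClass.measurableSet_setOf_notrace`), so the statement transports to the law `μ`.
Lawler (2005), §6.3 with Thm. 4.6. [cite: Lawler2005, §6.3] -/
theorem ae_nonTracing_of_isSLELaw {κ : ℝ≥0} {D : DobrushinDomain} {μ : Measure (CurveClass ℂ)}
    (h : IsSLELaw κ D μ) :
    ∀ᵐ γ ∂μ, ∀ c : Curve ℂ, CurveClass.mk c = γ →
      ∀ s t : I, s < t → c '' Icc s t ⊆ frontier D.carrier → (c '' Icc s t).Subsingleton := by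
  obtain ⟨Γ, ⟨hΓm, φ, -, hae⟩, rfl⟩ := h
  rw [ae_map_iff hΓm (CurveClass.measurableSet_setOf_notrace isClosed_frontier)]
  filter_upwards [hae] with ω ⟨hgen, c, hΓω, hc⟩
  rw [hΓω]
  refine (forall_rep_notrace_iff c (frontier D.carrier)).2 fun s t hst hsubF ↦ ?_
  rcases hst.lt_or_eq with hlt | rfl
  swap
  · rw [Icc_self, image_singleton]
    exact subsingleton_singleton
  exfalso
  -- an intermediate parameter `t₁ = (s + t)/2 ∈ (s, t)`, `t₁ < 1`
  have hlt' : (s : ℝ) < t := hlt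
  set t₁ : I := ⟨((s : ℝ) + t) / 2, by constructor <;> linarith [s.2.1, t.2.2]⟩ with ht₁
  have hst₁ : s < t₁ := show (s : ℝ) < ((s : ℝ) + t) / 2 by linarith
  have ht₁t : t₁ ≤ t := show ((s : ℝ) + t) / 2 ≤ t by linarith
  have ht₁1 : (t₁ : ℝ) < 1 := show ((s : ℝ) + t) / 2 < 1 by linarith [t.2.2]
  -- the trace visits `ℍ` during `[ray s, ray t₁]`
  obtain ⟨τ, ⟨hSτ, hτT⟩, hτ⟩ := Loewner.exists_mem_upperHalfPlaneSet_of_isGeneratedByCurve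
    (continuous_sleDriving κ ω) hgen (rayParam_lt_rayParam hst₁ ht₁1)
  obtain ⟨w, hw1, hwτ⟩ := exists_rayParam_eq τ
  have hsw : s ≤ w := by
    by_contra hws
    have h1 : rayParam w < rayParam s :=
      rayParam_lt_rayParam (not_le.1 hws) (lt_of_lt_of_le hlt' t.2.2)
    exact lt_irrefl _ ((hSτ.trans_eq hwτ.symm).trans_lt h1)
  have hwt₁ : w ≤ t₁ := by
    by_contra hw
    have h1 : rayParam t₁ < rayParam w := rayParam_lt_rayParam (not_le.1 hw) hw1
    exact lt_irrefl _ ((hwτ.trans_le hτT).trans_lt h1)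
  -- `c w = φ (γ τ) ∈ D`, but `c w ∈ ∂D`
  have hcw : c w ∈ frontier D.carrier := hsubF ⟨w, ⟨hsw, hwt₁.trans ht₁t⟩, rfl⟩
  rw [hc.1 w hw1, hwτ, φ.boundaryExtension_eq hτ] at hcw
  exact hcw.2 (by rw [D.isOpen.interior_eq]; exact φ.mapsTo hτ)

/-- **S6 (`stub_nonTracing`).** Chordal SLE₆ traces no boundary arc: for every family `Q` of
chordal SLE₆ laws and every Dobrushin domain `D`, `Q D`-a.e. curve class has no representative
mapping a non-trivial parameter interval into `∂D` non-constantly (`ae_nonTracing_of_isSLELaw`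
at `κ = 6`). Lawler (2005), §6.3 with Thm. 4.6. [cite: Lawler2005, §6.3] -/
theorem stub_nonTracing :
    ∀ Q : ChordalFamily, (∀ D : DobrushinDomain, IsSLELaw 6 D (Q D)) →
      ∀ D : DobrushinDomain, ∀ᵐ γ ∂(Q D), ∀ c : Curve ℂ, CurveClass.mk c = γ →
        ∀ s t : unitInterval, s < t → c '' Set.Icc s t ⊆ frontier D.carrier →
          (c '' Set.Icc s t).Subsingleton :=
  fun _ hQ D ↦ ae_nonTracing_of_isSLELaw (hQ D)

end Summit.CriticalPhenomena.CardyFormulaZ2.Theorems.CardyRotToConfR2SymmetryUpgrade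

end
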